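import Summits.CriticalPhenomena.PercolationContinuityZ3.Theorems.PercNearOneGluingNoHeavyLowerTailReduction
import Summits.CriticalPhenomena.PercolationContinuityZ3.Theorems.PercNearOneGluingNoHeavyLowerTailCSHTheoremOne
import HarnessLib

/-!
# The rate of the crux `NoHeavyLowerTail`: `δ(ε) = κ·ε` is admissible for every `κ ≤ (3 − √5)/2 ≈ 0.382` (tree: `1/16`)

builds on p205010 (kernel theorem, internal audit signed; external expert review pending)

PAPER-2 track "percolation constants", part (ii) (explicit constants across the CSH inequality family), seat `prim-consts-1`
(inventory; lane index `run/shared/lean/prim/consts/CONSTANTS.md`, row A17(b)).  Support file for the crux `NoHeavyLowerTail`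
(stmt-CriticalPhenomena-4575; `--supports … --as helper`): theorems only, no definitions, no sorries, standard axioms.

The crux (`Theses.PercNearOneGluing.NoHeavyLowerTail`) is an `∀ ε ∃ δ` statement: if `P(o ↔ A) > 1 − δ` (reach) and
`P(a ↔ a') > 1 − δ` for all `a, a' ∈ A` (pairwise reliability), then `P(1 ≤ N < δ·EN/ε) < ε`, where `N = |C(o) ∩ A|` and
`EN = Σ_{a∈A} P(o ↔ a)`.  The crux work file (`Cruxes/NoHeavyLowerTail/Disproof.lean`) records the LINEAR RATE `δ = ε/16`
(§C.2 `withoutReach_of_additiveGluing`, from the crux `AdditiveGluing`, without the reach hypothesis) and the necessity of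
`δ ≤ ε` (§D.3 `exists_bad_ge`, `not_noHeavyLowerTailRate`: no rate `κ ε` with `κ > 1`).  The `1/16` is a convenience constant:
the SAME two ingredients — `AdditiveGluing` (`CSH.additiveGluing_holds`) in its one-cut form `P(o ↔ A, o ↮ a₀) ≤ max_a P(a ↮ a₀)`
for a hub `a₀ ∈ A`, and Markov's inequality for the number of relay points cut from the hub (`nhlt_hubBlockMarkov`) — give
  `P(1 ≤ N < κ·EN) < κε + κε/(1 − κ)`   (pairwise reliability `κε`, `EN ≤ |A|`),
which is `≤ ε` exactly when `κ² − 3κ + 1 ≥ 0`, i.e. for every `κ ≤ (3 − √5)/2 = 0.38196…`.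

* `Consts.noHeavyLowerTail_rate` — for `0 < κ < 1` with `κ² − 3κ + 1 ≥ 0`: the rate-`κ` form of the crux holds on every finite
  weighted graph, WITHOUT the reach hypothesis;
* `Consts.noHeavyLowerTail_rate_sharpConst` — the instance `κ = (3 − √5)/2`; `Consts.three_sub_sqrt_five_div_two_bounds` —
  `3/8 < (3 − √5)/2 < 1/2` (so it beats the tree's `1/16` by a factor `> 6`); `Consts.noHeavyLowerTail_explicit_rate` /
  `Consts.noHeavyLowerTail_of_explicit_rate` — the crux's own `∀ ε ∃ δ` shape with the explicit witness `δ = (3 − √5)/2 · ε`.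
The necessity side (`κ ≤ 1`) lives in the crux work file; the window `κ* ∈ [(3−√5)/2, 1]` is open.
References: G. Kozma, N. Nitzan, arXiv:2401.12397 (2024), Conjecture 1 (p. 3), Lemma 2.
-/

noncomputable section

namespace Summit.CriticalPhenomena.PercolationContinuityZ3.Theorems

open MeasureTheory Set Literature.Probability.LatticeModels Literature.Probability.Percolation
open scoped Classical

namespace Consts

/-- One-cut form of `AdditiveGluing` (constant `1`): for `b ∈ A` with `P(a ↮ b) ≤ t` (`a ∈ A`), `P(o ↔ A, o ↮ b) ≤ t`.
(Same statement as `Consts.real_reach_sdiff_openConn_le` of `…ConstsLowerTailNoLog`; re-proved here to keep the file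
independent of that module.) [cite: KozmaNitzan2024, Conj. 1 (p. 3)] -/
private theorem reach_sdiff_le (n : ℕ) (w : Sym2 (Fin n) → unitInterval) (A : Finset (Fin n)) (o b : Fin n)
    (t : ℝ) (hb : b ∈ A) (hrel : ∀ a ∈ A, (prodBernoulli w).real (openConn a b)ᶜ ≤ t) :
    (prodBernoulli w).real ((⋃ a ∈ A, openConn o a) \ openConn o b) ≤ t := by
  have ht : 0 ≤ t := le_trans measureReal_nonneg (hrel b hb)
  have hrel' : ∀ a ∈ A, 1 - t ≤ (prodBernoulli w).real (openConn a b) := by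
    intro a ha
    have hc : (prodBernoulli w).real (openConn a b)ᶜ = 1 - (prodBernoulli w).real (openConn a b) := by
      rw [measureReal_compl MeasurableSet.of_discrete, probReal_univ]
    have := hrel a ha
    linarith
  have hAG := CSH.additiveGluing_holds n w A o b t ht hrel'
  have hsub : (openConn o b : Set (BondConfig (Fin n))) ⊆ ⋃ a ∈ A, openConn o a := fun ω hω =>
    Set.mem_iUnion₂.2 ⟨b, hb, hω⟩
  rw [measureReal_sdiff hsub MeasurableSet.of_discrete (measure_ne_top _ _)]
  linarith

/-- **The rate `δ = κ ε` of `NoHeavyLowerTail`, for every `κ ∈ (0,1)` with `κ² − 3κ + 1 ≥ 0` (i.e. `κ ≤ (3 − √5)/2`), and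
without the reach hypothesis.**  If every pair of relay points satisfies `P(a ↔ a') > 1 − κε`, then
`P(1 ≤ N < κε·EN/ε) < ε` (`N = |C(o) ∩ A|`, `EN = Σ_a P(o ↔ a)`).  Proof: empty `A` — the event is empty; otherwise fix a hub
`a₀ ∈ A`; on `{o ↮ a₀}` the event lies in `{o ↔ A} ∖ {o ↔ a₀}`, of mass `≤ κε` (one-cut `AdditiveGluing`); on `{o ↔ a₀}` it says
that more than `|A| − κ·EN ≥ (1−κ)|A|` relay points are cut from the hub, of mass `< |A|κε / ((1−κ)|A|)` (Markov,
`nhlt_hubBlockMarkov`); and `κε + κε/(1−κ) ≤ ε` iff `κ² − 3κ + 1 ≥ 0`. [cite: KozmaNitzan2024, Conj. 1 (p. 3)] -/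
theorem noHeavyLowerTail_rate {κ : ℝ} (hκ0 : 0 < κ) (hκ1 : κ < 1) (hq : 0 ≤ κ ^ 2 - 3 * κ + 1) :
    ∀ ε : ℝ, 0 < ε → ∀ (n : ℕ) (w : Sym2 (Fin n) → unitInterval) (A : Finset (Fin n)) (o : Fin n),
      (∀ a ∈ A, ∀ a' ∈ A, 1 - κ * ε < (prodBernoulli w).real (openConn a a')) →
      (prodBernoulli w).real {ω : BondConfig (Fin n) | 1 ≤ (A.filter fun a => ω ∈ openConn o a).card ∧
          ((A.filter fun a => ω ∈ openConn o a).card : ℝ) <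
            κ * ε * (∑ a ∈ A, (prodBernoulli w).real (openConn o a)) / ε} < ε := by
  intro ε hε n w A o hpair
  rcases A.eq_empty_or_nonempty with hA | ⟨a₀, ha₀⟩
  · -- empty relay set: the bad event is empty
    have hempty : {ω : BondConfig (Fin n) | 1 ≤ (A.filter fun a => ω ∈ openConn o a).card ∧
        ((A.filter fun a => ω ∈ openConn o a).card : ℝ) <
          κ * ε * (∑ a ∈ A, (prodBernoulli w).real (openConn o a)) / ε} = ∅ := by
      ext ω
      simp only [hA, Finset.filter_empty, Finset.card_empty, mem_setOf_eq, mem_empty_iff_false, iff_false, not_and]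
      intro h
      exact absurd h (by norm_num)
    rw [hempty, measureReal_empty]
    exact hε
  · -- nonempty relay set: hub `a₀`
    set μ := prodBernoulli w with hμ
    set EN : ℝ := ∑ a ∈ A, μ.real (openConn o a) with hEN
    set M : ℝ := (A.card : ℝ) with hMdef
    have hM1 : (1 : ℝ) ≤ M := by
      rw [hMdef]; exact_mod_cast Finset.card_pos.2 ⟨a₀, ha₀⟩
    have hENle : EN ≤ M := by
      calc EN = ∑ a ∈ A, μ.real (openConn o a) := rfl
        _ ≤ ∑ _a ∈ A, (1 : ℝ) := Finset.sum_le_sum fun a _ => measureReal_le_one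
        _ = M := by rw [Finset.sum_const, nsmul_eq_mul, mul_one]
    have hENnn : 0 ≤ EN := Finset.sum_nonneg fun a _ => measureReal_nonneg
    -- the threshold `κ ε EN / ε = κ EN =: t ≤ κ M < M`
    set t : ℝ := κ * EN with htdef
    have hthr : κ * ε * EN / ε = t := by
      rw [htdef]; field_simp
    have htM : t ≤ κ * M := by rw [htdef]; exact mul_le_mul_of_nonneg_left hENle hκ0.le
    have htlt : t < (A.card : ℝ) := by
      rw [← hMdef]; nlinarith
    -- star budget at the hub: `P(a ↮ a₀) < κ ε`
    have hstar : ∀ a ∈ A, μ.real (openConn a a₀)ᶜ < κ * ε := by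
      intro a ha
      rw [measureReal_compl MeasurableSet.of_discrete, probReal_univ]
      have := hpair a ha a₀ ha₀
      linarith
    -- piece 1: `o ↮ a₀` and `N ≥ 1`
    have h1 : μ.real ({ω : BondConfig (Fin n) | 1 ≤ (A.filter fun a => ω ∈ openConn o a).card ∧
        ((A.filter fun a => ω ∈ openConn o a).card : ℝ) < κ * ε * EN / ε} \ openConn o a₀) ≤ κ * ε := by
      refine le_trans (measureReal_mono ?_ (measure_ne_top _ _))
        (reach_sdiff_le n w A o a₀ (κ * ε) ha₀ fun a ha => (hstar a ha).le)
      rintro ω ⟨⟨hcard, -⟩, hno⟩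
      obtain ⟨a, ha⟩ := Finset.card_pos.1 hcard
      rw [Finset.mem_filter] at ha
      exact ⟨Set.mem_iUnion₂.2 ⟨a, ha.1, ha.2⟩, hno⟩
    -- piece 2: `o ↔ a₀` and `N < t`: Markov on the number of relay points cut from the hub
    have hsum : ∑ a ∈ A, μ.real (openConn a a₀)ᶜ < M * (κ * ε) := by
      calc ∑ a ∈ A, μ.real (openConn a a₀)ᶜ < ∑ _a ∈ A, κ * ε := Finset.sum_lt_sum_of_nonempty ⟨a₀, ha₀⟩ hstar
        _ = M * (κ * ε) := by rw [Finset.sum_const, nsmul_eq_mul]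
    have h2 : μ.real ({ω : BondConfig (Fin n) | 1 ≤ (A.filter fun a => ω ∈ openConn o a).card ∧
        ((A.filter fun a => ω ∈ openConn o a).card : ℝ) < κ * ε * EN / ε} ∩ openConn o a₀) < κ * ε / (1 - κ) := by
      have hmarkov := nhlt_hubBlockMarkov n w A o a₀ t htlt
      have hmono : μ.real ({ω : BondConfig (Fin n) | 1 ≤ (A.filter fun a => ω ∈ openConn o a).card ∧
          ((A.filter fun a => ω ∈ openConn o a).card : ℝ) < κ * ε * EN / ε} ∩ openConn o a₀) ≤
          μ.real {ω : BondConfig (Fin n) | ω ∈ openConn o a₀ ∧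
            ((A.filter fun a => ω ∈ openConn o a).card : ℝ) < t} := by
        refine measureReal_mono ?_ (measure_ne_top _ _)
        rintro ω ⟨⟨-, hlt⟩, hoa⟩
        exact ⟨hoa, by rwa [hthr] at hlt⟩
      have hden : 0 < (A.card : ℝ) - t := by linarith
      have hden' : M * (1 - κ) ≤ (A.card : ℝ) - t := by rw [← hMdef]; nlinarith
      have hMκ : 0 < M * (1 - κ) := by nlinarith
      calc μ.real ({ω : BondConfig (Fin n) | 1 ≤ (A.filter fun a => ω ∈ openConn o a).card ∧
            ((A.filter fun a => ω ∈ openConn o a).card : ℝ) < κ * ε * EN / ε} ∩ openConn o a₀)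
          ≤ (∑ a ∈ A, μ.real (openConn a a₀)ᶜ) / ((A.card : ℝ) - t) := hmono.trans hmarkov
        _ < M * (κ * ε) / ((A.card : ℝ) - t) := div_lt_div_of_pos_right hsum hden
        _ ≤ M * (κ * ε) / (M * (1 - κ)) := div_le_div_of_nonneg_left (by positivity) hMκ hden'
        _ = κ * ε / (1 - κ) := by
            rw [mul_div_mul_left _ _ (by positivity : M ≠ 0)]
    -- assemble: `μ(bad) = μ(bad ∩ {o ↔ a₀}) + μ(bad ∖ {o ↔ a₀}) < κε/(1−κ) + κε ≤ ε`
    have hsplit := measureReal_inter_add_sdiff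
      (μ := μ) (s := {ω : BondConfig (Fin n) | 1 ≤ (A.filter fun a => ω ∈ openConn o a).card ∧
        ((A.filter fun a => ω ∈ openConn o a).card : ℝ) < κ * ε * EN / ε})
      (t := (openConn o a₀ : Set (BondConfig (Fin n)))) MeasurableSet.of_discrete
    have hfin : κ * ε / (1 - κ) + κ * ε ≤ ε := by
      rw [div_add' _ _ _ (by linarith : (1 : ℝ) - κ ≠ 0), div_le_iff₀ (by linarith : (0 : ℝ) < 1 - κ)]
      nlinarith
    linarith

/-- `((3 − √5)/2)² − 3·(3 − √5)/2 + 1 = 0`: the constant `(3 − √5)/2` is the smaller root of `κ² − 3κ + 1`. [folklore] -/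
theorem sq_sub_three_mul_add_one_eq_zero :
    ((3 - Real.sqrt 5) / 2) ^ 2 - 3 * ((3 - Real.sqrt 5) / 2) + 1 = 0 := by
  have h5 : Real.sqrt 5 ^ 2 = 5 := Real.sq_sqrt (by norm_num)
  nlinarith [h5]

/-- `3/8 < (3 − √5)/2 < 1/2` (numerically `0.38196…`). [folklore] -/
theorem three_sub_sqrt_five_div_two_bounds :
    (3 : ℝ) / 8 < (3 - Real.sqrt 5) / 2 ∧ (3 - Real.sqrt 5) / 2 < 1 / 2 := by
  have h5 : Real.sqrt 5 ^ 2 = 5 := Real.sq_sqrt (by norm_num)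
  have h0 : 0 ≤ Real.sqrt 5 := Real.sqrt_nonneg 5
  constructor
  · -- `√5 < 9/4` since `5 < 81/16`
    nlinarith [h5, h0]
  · -- `2 < √5` since `4 < 5`
    nlinarith [h5, h0]

/-- **The rate `δ(ε) = (3 − √5)/2 · ε ≈ 0.382 ε` is admissible for `NoHeavyLowerTail`** (no reach hypothesis needed);
the crux work file has `1/16` (sufficient) and `κ ≤ 1` (necessary). [cite: KozmaNitzan2024, Conj. 1 (p. 3)] -/
theorem noHeavyLowerTail_rate_sharpConst :
    ∀ ε : ℝ, 0 < ε → ∀ (n : ℕ) (w : Sym2 (Fin n) → unitInterval) (A : Finset (Fin n)) (o : Fin n),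
      (∀ a ∈ A, ∀ a' ∈ A, 1 - (3 - Real.sqrt 5) / 2 * ε < (prodBernoulli w).real (openConn a a')) →
      (prodBernoulli w).real {ω : BondConfig (Fin n) | 1 ≤ (A.filter fun a => ω ∈ openConn o a).card ∧
          ((A.filter fun a => ω ∈ openConn o a).card : ℝ) <
            (3 - Real.sqrt 5) / 2 * ε * (∑ a ∈ A, (prodBernoulli w).real (openConn o a)) / ε} < ε :=
  noHeavyLowerTail_rate (by linarith [three_sub_sqrt_five_div_two_bounds.1])
    (by linarith [three_sub_sqrt_five_div_two_bounds.2]) (le_of_eq sq_sub_three_mul_add_one_eq_zero.symm)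

/-- **In the crux's own `∀ ε ∃ δ` shape**: `NoHeavyLowerTail` holds with the explicit witness `δ = (3 − √5)/2 · ε`
(the reach hypothesis is not used). [cite: KozmaNitzan2024, Conj. 1 (p. 3)] -/
theorem noHeavyLowerTail_explicit_rate :
    ∀ ε : ℝ, 0 < ε → ∃ δ : ℝ, δ = (3 - Real.sqrt 5) / 2 * ε ∧ 0 < δ ∧
      ∀ (n : ℕ) (w : Sym2 (Fin n) → unitInterval) (A : Finset (Fin n)) (o : Fin n),
        1 - δ < (prodBernoulli w).real (⋃ a ∈ A, openConn o a) →
        (∀ a ∈ A, ∀ a' ∈ A, 1 - δ < (prodBernoulli w).real (openConn a a')) →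
        (prodBernoulli w).real {ω : BondConfig (Fin n) | 1 ≤ (A.filter fun a => ω ∈ openConn o a).card ∧
          ((A.filter fun a => ω ∈ openConn o a).card : ℝ) <
            δ * (∑ a ∈ A, (prodBernoulli w).real (openConn o a)) / ε} < ε := by
  intro ε hε
  refine ⟨(3 - Real.sqrt 5) / 2 * ε, rfl, mul_pos (by linarith [three_sub_sqrt_five_div_two_bounds.1]) hε, ?_⟩
  intro n w A o _ hpair
  exact noHeavyLowerTail_rate_sharpConst ε hε n w A o hpair

/-- Sanity link to the route declaration: the explicit rate re-proves the crux `NoHeavyLowerTail` (already a tree theorem,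
`CSH.noHeavyLowerTail_holds`). [cite: KozmaNitzan2024, Conj. 1 (p. 3)] -/
theorem noHeavyLowerTail_of_explicit_rate : Theses.PercNearOneGluing.NoHeavyLowerTail := by
  intro ε hε
  obtain ⟨δ, -, hδ, h⟩ := noHeavyLowerTail_explicit_rate ε hε
  exact ⟨δ, hδ, h⟩

end Consts

end Summit.CriticalPhenomena.PercolationContinuityZ3.Theorems
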